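import Summits.NavierStokesRegularity.NavierStokesRegularity.Theorems.NoOverheating.Negative.ExcludedStrataCensusV15
import Summits.NavierStokesRegularity.NavierStokesRegularity.Theorems.NoOverheating.Negative.SelfSimilarSlicesExcluded

/-!
# KJ-70b — CENSUS v16 of the excluded strata of route `AngularGalerkinLadder`'s window sequences
# ((S0)–(S29) of `excludedStrata_windowSequences_v15` + (S30) window slices self-similar under ONE
# contraction with ANY amplitude factor — every degree of homogeneity — exactly at some index or
# asymptotically along the sequence)

Refuter lineage, Negative lane of crux K2 `NoOverheating` (supports, does not decide).  Pure
assembly — this file proves NOTHING new: it folds kernel row KJ-70 (`SelfSimilarSlicesExcluded`)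
into the census statement of record, `excludedStrata_windowSequences_v16`, "what an admissible
window sequence of K2 can NOT be":

* (S30) for some index `n`, ONE `λ₀ ∈ (0, 1)` and one `μ ∈ ℝ`, `μ uₙ(−1, λ₀ x) = uₙ(−1, x)` for
  all `x` (`…SelfSimilarSlicesExcluded.no_windowProfile_selfSimilarSlice`: contraction into the
  origin when `|μ| < 1`, expansion against the Type-I decay when `|μ| ≥ 1`), or the window slices
  are asymptotically so, `μ uₙ(−1, λ₀ x) − uₙ(−1, x) → 0` pointwise
  (`…no_windowSequence_asymptoticallySelfSimilarSlice`).  (S29) is `μ = λ₀`; `μ = 1` is the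
  conical / dilation-invariant window slice.

Census sentence after v16: as v15, with the homogeneity clause in final form — the window slice of
a supply admits NO discrete spatial self-similarity of ANY degree, exactly or asymptotically.
[cite: KochNadirashviliSereginSverak2009, Lemma 6.1 (limits of rescaled solutions)] -/

namespace Summit.NavierStokesRegularity.AngularGalerkinLadderExcludedStrataCensusV16

open Set Filter MeasureTheory Topology Function
open scoped ENNReal
open Literature.Analysis Literature.Analysis.FluidPDE
open Summit.NavierStokesRegularity.FluidComputer
open Summit.NavierStokesRegularity.NavierStokesRegularity.Theses.AngularGalerkinLadder
open Summit.NavierStokesRegularity.AngularGalerkinLadderExcludedStrataCensusV15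
open Summit.NavierStokesRegularity.AngularGalerkinLadderSelfSimilarSlicesExcluded

/-- **Census theorem v16: the excluded strata (S0)–(S30) of K2's window sequences.**  As
`excludedStrata_windowSequences_v15`, plus (S30): a window slice self-similar under ONE contraction
with ANY amplitude factor at some index, or asymptotically so along the sequence — for ANY `C₀`,
ANY window and ANY rotations. [cite: KochNadirashviliSereginSverak2009, Lemma 6.1 (limits of rescaled solutions)] -/
theorem excludedStrata_windowSequences_v16 :
    ∃ ε₀ : ℝ, 0 < ε₀ ∧ ∀ C₀ : ℝ, ∃ κ α₁ c₁ α₂ c₂ lam₁ β₁ β₂ lam₂ : ℝ,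
      1 < κ ∧ 0 < α₁ ∧ 1 < c₁ ∧ 0 < α₂ ∧ 1 < c₂ ∧ 1 < lam₁ ∧ 0 < β₁ ∧ 0 < β₂ ∧ 1 < lam₂ ∧
      ∀ {cmin cmax δ : ℝ} {L : ℕ → ℕ} {ε c : ℕ → ℝ}
        {R : ℕ → (EuclideanSpace ℝ (Fin 3) ≃ₗᵢ[ℝ] EuclideanSpace ℝ (Fin 3))}
        {u : ℕ → ℝ → EuclideanSpace ℝ (Fin 3) → EuclideanSpace ℝ (Fin 3)}
        {p : ℕ → ℝ → EuclideanSpace ℝ (Fin 3) → ℝ}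
        {d : ℕ → ℝ → EuclideanSpace ℝ (Fin 3) → EuclideanSpace ℝ (Fin 3)},
        1 < cmin → 0 < δ → Tendsto ε atTop (𝓝 0) →
        (∀ n, AngularLadder.IsWindowProfile (L n) C₀ cmin cmax δ (ε n) (c n) (R n) (u n) (p n)
          (d n)) →
        ¬ (C₀ ≤ ε₀ ∨
           (∀ n, ∀ t < 0, IsAxisymmetric (u n t)) ∨
           (∃ q : ℕ, 0 < q ∧ cmax ^ q < κ ∧
              ∀ x, Tendsto (fun n => ((R n) ^ q) x) atTop (𝓝 x)) ∨
           (∃ (q : ℕ) (g : ℕ → (EuclideanSpace ℝ (Fin 3) ≃ₗᵢ[ℝ] EuclideanSpace ℝ (Fin 3)))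
              (θ : ℕ → ℝ),
              0 < q ∧ cmax ^ q < c₁ ∧ (∀ n x, ((R n) ^ q) x = g n (rotZ (θ n) ((g n).symm x))) ∧
              ∀ n, |θ n| ≤ 2 * α₁ * (q * Real.log (c n))) ∨
           (∃ (Θ ℓ : ℝ) (g : ℕ → (EuclideanSpace ℝ (Fin 3) ≃ₗᵢ[ℝ] EuclideanSpace ℝ (Fin 3)))
              (θ : ℕ → ℝ),
              ℓ < Real.log c₂ ∧ (∀ n x, R n x = g n (rotZ (θ n) ((g n).symm x))) ∧
              (∀ n, |θ n| ≤ Θ) ∧ (∀ n, 2 * α₂ * Real.log (c n) ≤ |θ n|) ∧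
              ∀ n, (1 + (θ n / (2 * Real.log (c n))) ^ 2) * Real.log (c n) ≤ ℓ) ∨
           (∃ lam : ℝ, 1 < lam ∧ lam < lam₁ ∧ ∀ n, IsDiscretelySelfSimilar lam (u n)) ∨
           (∀ n, IsSelfSimilar (u n)) ∨
           (∃ (g : ℕ → (EuclideanSpace ℝ (Fin 3) ≃ₗᵢ[ℝ] EuclideanSpace ℝ (Fin 3))) (α : ℕ → ℝ),
              (∀ n (μ : ℝ), 1 < μ → IsRotatedDSS μ
                (((g n).symm.trans (rotZLIE (2 * α n * Real.log μ))).trans (g n)) (u n)) ∧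
              ∀ n, |α n| ≤ β₁ ∨ β₂ ≤ |α n|) ∨
           (∃ M : ℝ≥0∞, M < ⊤ ∧ ∀ n, eLpNorm (u n (-1)) 3 volume ≤ M) ∨
           (∃ M : ℝ≥0∞, M < ⊤ ∧ ∀ n, eLpNorm (u n (-1)) 2 volume ≤ M) ∨
           (∀ η : ℝ, 0 < η → ∃ ρ : ℝ, ∀ n x, ρ ≤ ‖x‖ → ‖x‖ * ‖u n (-1) x‖ ≤ η) ∨
           (∀ n, ∀ t < 0, ∃ e : EuclideanSpace ℝ (Fin 3), ∀ x,
              curl (u n t) x = ‖curl (u n t) x‖ • e) ∨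
           (∀ n, ∃ (d₀ : ℝ) (η : ℝ → ℝ), Tendsto η (𝓝[>] 0) (𝓝 0) ∧
              ∀ s ∈ Ioo (-1 : ℝ) 0, ∀ x y, d₀ < ‖curl (u n s) x‖ → d₀ < ‖curl (u n s) y‖ →
                ‖vorticityDirection (curl (u n s)) x - vorticityDirection (curl (u n s)) y‖ ≤
                  η ‖x - y‖) ∨
           (∃ (n : ℕ) (S : EuclideanSpace ℝ (Fin 3) ≃ₗᵢ[ℝ] EuclideanSpace ℝ (Fin 3))
              (b : EuclideanSpace ℝ (Fin 3)), S b = b ∧ b ≠ 0 ∧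
              ∀ x, ‖u n (-1) (S x + b)‖ = ‖u n (-1) x‖) ∨
           (∃ (n : ℕ) (ρ B : ℝ), 0 < ρ ∧
              ∀ z ∈ parabolicCylinder ρ (0 : ℝ × EuclideanSpace ℝ (Fin 3)), ‖u n z.1 z.2‖ ≤ B) ∨
           (∃ (n : ℕ) (U : EuclideanSpace ℝ (Fin 3) → EuclideanSpace ℝ (Fin 3)),
              Continuous U ∧ ∀ t < 0, u n t = U) ∨
           (∃ (n : ℕ) (e : EuclideanSpace ℝ (Fin 3)), ∀ x, ∃ a : ℝ,
              curl (u n (-1)) x = a • e) ∨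
           (∃ (n : ℕ) (d₀ : ℝ) (η : ℝ → ℝ), Tendsto η (𝓝[>] 0) (𝓝 0) ∧
              ∀ s ∈ Ioo (-1 : ℝ) 0, ∀ x y, d₀ < ‖curl (u n s) x‖ → d₀ < ‖curl (u n s) y‖ →
                min ‖vorticityDirection (curl (u n s)) x - vorticityDirection (curl (u n s)) y‖
                    ‖vorticityDirection (curl (u n s)) x + vorticityDirection (curl (u n s)) y‖ ≤
                  η ‖x - y‖) ∨
           (∃ (n : ℕ) (ρ M : ℝ), 0 < ρ ∧
              ∀ z ∈ parabolicCylinder ρ (0 : ℝ × EuclideanSpace ℝ (Fin 3)),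
                ‖curl (u n z.1) z.2‖ ≤ M) ∨
           (∃ (n : ℕ) (e : EuclideanSpace ℝ (Fin 3)) (ρ M : ℝ), (R n e = e ∨ R n e = -e) ∧
              0 < ρ ∧ ∀ z ∈ parabolicCylinder ρ (0 : ℝ × EuclideanSpace ℝ (Fin 3)),
                ∃ a : ℝ, ‖u n z.1 z.2 - a • e‖ ≤ M) ∨
           (∃ (n : ℕ) (e : EuclideanSpace ℝ (Fin 3)) (ρ M : ℝ), (R n e = e ∨ R n e = -e) ∧
              0 < ρ ∧ ∀ z ∈ parabolicCylinder ρ (0 : ℝ × EuclideanSpace ℝ (Fin 3)),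
                ∃ a : ℝ, ‖curl (u n z.1) z.2 - a • e‖ ≤ M) ∨
           (∃ (n : ℕ) (S : EuclideanSpace ℝ (Fin 3) ≃ₗᵢ[ℝ] EuclideanSpace ℝ (Fin 3))
              (b : EuclideanSpace ℝ (Fin 3)), S b = b ∧ b ≠ 0 ∧
              ∀ x, ‖u n (-1) x‖ ≤ ‖u n (-1) (S x + b)‖) ∨
           (∃ A : ℕ → (EuclideanSpace ℝ (Fin 3) ≃ₗᵢ[ℝ] EuclideanSpace ℝ (Fin 3)),
              ∀ θ, ∀ t < 0, ∀ x,
                Tendsto (fun n => (A n).symm (u n t (A n (rotZ θ x))) -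
                  rotZ θ ((A n).symm (u n t (A n x)))) atTop (𝓝 0)) ∨
           (∃ (S : EuclideanSpace ℝ (Fin 3) ≃ₗᵢ[ℝ] EuclideanSpace ℝ (Fin 3))
              (b : EuclideanSpace ℝ (Fin 3)), S b = b ∧ b ≠ 0 ∧
              ∀ x, Tendsto (fun n => ‖u n (-1) (S x + b)‖ - ‖u n (-1) x‖) atTop (𝓝 0)) ∨
           (∀ s < 0, ∀ t < 0, ∀ x, Tendsto (fun n => u n t x - u n s x) atTop (𝓝 0)) ∨
           (∃ (A : ℕ → (EuclideanSpace ℝ (Fin 3) ≃ₗᵢ[ℝ] EuclideanSpace ℝ (Fin 3))) (α : ℕ → ℝ),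
              Tendsto α atTop (𝓝 0) ∧ (∀ n, α n ≠ 0) ∧ ∀ n, ∀ t < 0, ∀ x,
                (A n).symm (u n t (A n (rotZ (α n) x))) =
                  rotZ (α n) ((A n).symm (u n t (A n x)))) ∨
           (∃ σ : ℕ → ℝ, (∀ n, 1 < σ n) ∧ Tendsto σ atTop (𝓝 1) ∧
              ∀ n, IsDiscretelySelfSimilar (σ n) (u n)) ∨
           (∃ lam : ℝ, 1 < lam ∧ lam < lam₂ ∧ ∀ t < 0, ∀ x,
              Tendsto (fun n => lam • u n (lam ^ 2 * t) (lam • x) - u n t x) atTop (𝓝 0)) ∨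
           (∃ (n : ℕ) (τ : ℝ), 0 < τ ∧ ∀ t < 0, ∀ x, u n (t - τ) x = u n t x) ∨
           (∃ (τ : ℕ → ℝ) (τ₀ : ℝ), 0 < τ₀ ∧ Tendsto τ atTop (𝓝 τ₀) ∧
              ∀ t < 0, ∀ x, Tendsto (fun n => u n (t - τ n) x - u n t x) atTop (𝓝 0)) ∨
           (∃ (n : ℕ) (U : EuclideanSpace ℝ (Fin 3) → EuclideanSpace ℝ (Fin 3))
              (b : EuclideanSpace ℝ (Fin 3)), ∀ t < 0, ∀ x, u n t x = U (x - t • b)) ∨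
           (∃ b : EuclideanSpace ℝ (Fin 3), ∀ s < 0, ∀ t < 0, ∀ x,
              Tendsto (fun n => u n t (x + t • b) - u n s (x + s • b)) atTop (𝓝 0)) ∨
           (∃ n : ℕ, ∀ lam : ℝ, 0 < lam → lam < 1 → ∀ x,
              lam • u n (-1) (lam • x) = u n (-1) x) ∨
           (∀ lam : ℝ, 0 < lam → lam < 1 → ∀ x,
              Tendsto (fun n => lam • u n (-1) (lam • x) - u n (-1) x) atTop (𝓝 0)) ∨
           (∃ (n : ℕ) (g : ℝ → (EuclideanSpace ℝ (Fin 3) ≃ₗᵢ[ℝ] EuclideanSpace ℝ (Fin 3))),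
              ∀ s < 0, ∀ t < 0, ∀ x, ‖u n s (g s x)‖ = ‖u n t (g t x)‖) ∨
           (∃ g : ℝ → (EuclideanSpace ℝ (Fin 3) ≃ₗᵢ[ℝ] EuclideanSpace ℝ (Fin 3)),
              ∀ s < 0, ∀ t < 0, ∀ x,
                Tendsto (fun n => ‖u n s (g s x)‖ - ‖u n t (g t x)‖) atTop (𝓝 0)) ∨
           (∃ (n : ℕ) (lam : ℝ), 0 < lam ∧ lam < 1 ∧ ∀ x,
              lam • u n (-1) (lam • x) = u n (-1) x) ∨
           (∃ lam : ℝ, 0 < lam ∧ lam < 1 ∧ ∀ x,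
              Tendsto (fun n => lam • u n (-1) (lam • x) - u n (-1) x) atTop (𝓝 0)) ∨
           (∃ (n : ℕ) (lam μ : ℝ), 0 < lam ∧ lam < 1 ∧ ∀ x,
              μ • u n (-1) (lam • x) = u n (-1) x) ∨
           (∃ lam μ : ℝ, 0 < lam ∧ lam < 1 ∧ ∀ x,
              Tendsto (fun n => μ • u n (-1) (lam • x) - u n (-1) x) atTop (𝓝 0))) := by
  obtain ⟨ε₀, hε₀, H⟩ := excludedStrata_windowSequences_v15
  refine ⟨ε₀, hε₀, fun C₀ => ?_⟩
  obtain ⟨κ, α₁, c₁, α₂, c₂, lam₁, β₁, β₂, lam₂, hκ, hα₁, hc₁, hα₂, hc₂, hlam₁, hβ₁, hβ₂, hlam₂,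
    HC⟩ := H C₀
  refine ⟨κ, α₁, c₁, α₂, c₂, lam₁, β₁, β₂, lam₂, hκ, hα₁, hc₁, hα₂, hc₂, hlam₁, hβ₁, hβ₂, hlam₂,
    fun {cmin cmax δ L ε c R u p d} hcmin hδ hε hW => ?_⟩
  have HC' := HC hcmin hδ hε hW
  simp only [not_or] at HC' ⊢
  obtain ⟨h0, h1, h2, h3, h4, h5, h6, h7, h8, h9, h10, h11, h12, h13, h14, h15, h16, h17, h18, h19,
    h20, h21, h22, h23, h24, h25, h26, h27, h28, h29, h30, h31, h32, h33, h34, h35, h36, h37⟩ := HC'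
  exact ⟨h0, h1, h2, h3, h4, h5, h6, h7, h8, h9, h10, h11, h12, h13, h14, h15, h16, h17, h18, h19,
    h20, h21, h22, h23, h24, h25, h26, h27, h28, h29, h30, h31, h32, h33, h34, h35, h36, h37,
    fun ⟨n, lam, μ, hl0, hl1, hss⟩ => no_windowProfile_selfSimilarSlice hδ (hW n) hl0 hl1 μ hss,
    no_windowSequence_asymptoticallySelfSimilarSlice_census hcmin hδ hε hW⟩

end Summit.NavierStokesRegularity.AngularGalerkinLadderExcludedStrataCensusV16
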